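import Summits.BirchSwinnertonDyer.BirchSwinnertonDyer.Theorems.AdditiveBranchIMCGordTwoRankZeroOffCaseOneFieldSupplyR0TameTwist
import Literature.NumberTheory.EllipticCurves.QuadraticTwistKroneckerRootNumberProofs
import Literature.NumberTheory.EllipticCurves.ModularParametrizationBCDTProofs
import Literature.NumberTheory.EllipticCurves.RootNumberSmulProofs
import Literature.NumberTheory.EllipticCurves.SzpiroOfAbcProofs
import Literature.NumberTheory.EllipticCurves.HeegnerHypothesisKroneckerProofs
import Summits.BirchSwinnertonDyer.BirchSwinnertonDyer.Theorems.AdditiveKolyvaginRoadRamifiedHabitatPStarTwistLocal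
import HarnessLib

/-!
# Route `AdditiveBranchIMC` (rung K1), cruxes 19357 / 19359, supply stubs: FIELD 2, part 1 —
# the good-ordinary `p*`-partner `V` of a (G-ord, `e = 2`) curve, its root number, and the genus
# factor `δ₁ = d_K / q*` of the tame-road field

Cell `bsd-addord`, seat `bsd-line-addord-w2`. THEOREMS ONLY. Inputs are explicit hypotheses
(modularity as `exists_isNewformOf`, obtained from `nonempty_modularParametrizationData`).

(`p* ≡ 1 (mod 4)` and "a prime dividing `p*` is `p`" are REUSED from
`Theorems.AdditiveKoly.RamifiedHabitat`; `p* ≠ 0` from `Additive.pStar_ne_zero`.)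

* `exists_goodOrd_partner_rootNumber` — for `(E, p)` on the (G-ord, `e = 2`) cell, `p ≥ 5`: a globally
  minimal `V` with `C • V = E^{(p*)}`, `GoodOrd V p`, `N_E = N_V p²`, `p ∤ N_V`, and
  `w(E) = (−1/p)(N_V/p)·w(V)` (`rootNumber_quadraticTwist_of_emod_four_eq_one` at `D = p*`, read on
  `E ≅ V^{(p*)}`).
* `genusFactor` lemmas — `d_K = q* δ₁` with `δ₁ ≡ 1 (mod 4)` square-free, `q ∤ δ₁`, `p ∤ δ₁`, and every
  prime of `δ₁` a good prime of `E` (the other bad primes of `E` split in `K`).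

References: [SilvermanAEC2009] X.5.4, App. C §16; Murty–Murty 1997 Ch. 6 §1; [AtkinLehner1970] §6.
-/

set_option linter.dupNamespace false

noncomputable section

open scoped Classical

open WeierstrassCurve NumberField IsDedekindDomain
  Literature.NumberTheory.EllipticCurves
  Literature.NumberTheory.EllipticCurves.ModularForms
  Literature.NumberTheory.EllipticCurves.Rank1Residual
  Literature.NumberTheory.QuadraticFields
  Summit.BirchSwinnertonDyer.Rank1Residual
  Summit.BirchSwinnertonDyer.Rank1Residual.Additive

namespace Summit.BirchSwinnertonDyer.BirchSwinnertonDyer.Theorems.ThreeFieldRoadSupply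

open NumberTheorySymbols
open Summit.BirchSwinnertonDyer.BirchSwinnertonDyer.Theorems.AdditiveKoly.RamifiedHabitat (pStar_emod_four eq_of_prime_dvd_pStar)

/-! ### §1 `p* = (−1)^{(p−1)/2} p` -/

section PStar

variable {p : ℕ} [hp : Fact p.Prime]

/-- `p*` is square-free. [folklore] -/
theorem squarefree_pStar : Squarefree ((-1 : ℤ) ^ (p / 2) * p) := by
  have hpr : Prime (p : ℤ) := Nat.prime_iff_prime_int.mp hp.out
  rcases neg_one_pow_eq_or ℤ (p / 2) with h | h <;> rw [h]
  · simpa using hpr.squarefree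
  · simpa using hpr.neg.squarefree

omit hp in
/-- `|p*| = p`. [folklore] -/
theorem natAbs_pStar : ((-1 : ℤ) ^ (p / 2) * p).natAbs = p := by
  rw [Int.natAbs_mul, Int.natAbs_pow]
  simp

omit hp in
/-- The rational `p*` is the cast of the integer `p*`. [folklore] -/
theorem pStar_cast : (((-1 : ℤ) ^ (p / 2) * p : ℤ) : ℚ) = (-1 : ℚ) ^ (p / 2) * p := by push_cast; ring

end PStar

/-! ### §2 The good-ordinary `p*`-partner and its root number -/

section Partner

variable (W : WeierstrassCurve ℚ) [W.IsElliptic] [W.IsGloballyMinimal] (p : ℕ) [hp : Fact p.Prime]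

/-- **The good-ordinary partner of a (G-ord, `e = 2`) pair and the root-number relation.** For `(E, p)`
on `N10.CellGordTwo` with `p ≥ 5` (and modularity `exists_isNewformOf`): a globally minimal `V` and a
change of variables `C` with `C • V = E^{(p*)}` (so `E ≅ V^{(p*)}`), `V` good ordinary at `p`
(`typeGOrd_iff_goodOrd_twist_pStar`), `N_E = N_V · p²` and
`w(E) = J(−1 | p) · J(N_V | p) · w(V)` (the twisting formula at the odd fundamental discriminant `p*`,
prime to `N_V`). [cite: SilvermanAEC2009, X.5 Cor. 5.4] [cite: AtkinLehner1970, §6] -/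
theorem exists_goodOrd_partner_rootNumber (hmod : exists_isNewformOf) (hp5 : 5 ≤ p)
    (hcell : N10.CellGordTwo W p) :
    ∃ (V : WeierstrassCurve ℚ) (_ : V.IsElliptic) (_ : V.IsGloballyMinimal) (C : VariableChange ℚ),
      C • V = W.quadraticTwist ((-1 : ℚ) ^ (p / 2) * p) ∧ GoodOrd V p ∧
        (∃ C' : VariableChange ℚ, C' • V.quadraticTwist ((-1 : ℚ) ^ (p / 2) * p) = W) ∧
        W.conductorNorm ℤ = V.conductorNorm ℤ * p ^ 2 ∧ ¬ p ∣ V.conductorNorm ℤ ∧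
        W.rootNumber = J(-1 | p) * J((V.conductorNorm ℤ : ℤ) | p) * V.rootNumber := by
  have hp2 : p ≠ 2 := by omega
  obtain ⟨-, -, hG, he⟩ := hcell
  obtain ⟨V, iV, iVm, CV, hCV⟩ :=
    exists_isGloballyMinimal_smul_eq_quadraticTwist W (pStar_ne_zero p)
  have hV : CV⁻¹ • W.quadraticTwist ((-1 : ℚ) ^ (p / 2) * p) = V := by rw [← hCV, inv_smul_smul]
  have hordV : GoodOrd V p := (typeGOrd_iff_goodOrd_twist_pStar W p hp5 he V CV⁻¹ hV).mp hG
  -- `E ≅ V^{(p*)}`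
  obtain ⟨C', hC'⟩ := Additive.exists_variableChange_quadraticTwist_symm V W
    (pStar_ne_zero p) ⟨CV⁻¹, hV⟩
  have hpN : ¬ p ∣ V.conductorNorm ℤ := fun h ↦
    ((V.dvd_conductorNorm_iff_not_hasGoodReductionAtPrime p).mp h) hordV.1
  have hgcd : Int.gcd ((-1 : ℤ) ^ (p / 2) * p) (V.conductorNorm ℤ) = 1 := by
    rw [Int.gcd_eq_natAbs, natAbs_pStar, Int.natAbs_natCast]
    exact (Nat.Prime.coprime_iff_not_dvd hp.out).mpr hpN
  obtain ⟨hroot, hcond⟩ := V.rootNumber_quadraticTwist_of_emod_four_eq_one hmod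
    (pStar_emod_four (p := p) hp2) squarefree_pStar hgcd
  rw [natAbs_pStar, pStar_cast] at hroot hcond
  haveI := V.isElliptic_quadraticTwist (pStar_ne_zero p)
  have hrootW : W.rootNumber = (V.quadraticTwist ((-1 : ℚ) ^ (p / 2) * p)).rootNumber := by
    rw [← hC']; exact (V.quadraticTwist _).rootNumber_smul_holds C'
  have hcondW : W.conductorNorm ℤ = (V.quadraticTwist ((-1 : ℚ) ^ (p / 2) * p)).conductorNorm ℤ := by
    rw [← hC', conductorNorm_smul_rat]
  refine ⟨V, iV, iVm, CV, hCV, hordV, ⟨C', hC'⟩, ?_, hpN, ?_⟩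
  · rw [hcondW, hcond]
  · rw [hrootW, hroot]

end Partner

/-! ### §3 The genus factor `δ₁ = d_K / q*` of the tame-road field -/

section GenusFactor

variable {p q : ℕ} [hp : Fact p.Prime] [hq : Fact q.Prime]
  (W : WeierstrassCurve ℚ) (K : Type) [Field K] [NumberField K]

/-- **The genus factor of the tame-road field.** For `K` imaginary quadratic with `2` split (so `d_K`
is odd, `≡ 1 (mod 4)`, square-free), an odd prime `q ∣ d_K`, every prime `ℓ ∣ N_E` other than `q`
split in `K`, and `p ∣ N_E`, `p ≠ q`: with `δ₁ := d_K / q*` one has `d_K = q* δ₁`, `δ₁ ≡ 1 (mod 4)`,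
`δ₁` square-free, `q ∤ δ₁`, `p ∤ δ₁`, and no prime of `δ₁` divides `N_E`.
[cite: Cox2013, §1.C Lemma 1.14 (genus factorisation of a discriminant)] -/
theorem genusFactor_spec (hK : IsImaginaryQuadratic K)
    (h2K : ((Ideal.span {(2 : ℤ)}).primesOver (𝓞 K)).ncard = 2) (hq2 : q ≠ 2)
    (hqd : (q : ℤ) ∣ NumberField.discr K)
    (hsplit : ∀ ℓ : ℕ, ℓ.Prime → ℓ ∣ W.conductorNorm ℤ → ℓ ≠ q →
      ((Ideal.span {(ℓ : ℤ)}).primesOver (𝓞 K)).ncard = 2)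
    (hpN : p ∣ W.conductorNorm ℤ) (hpq : p ≠ q) :
    NumberField.discr K = ((-1 : ℤ) ^ (q / 2) * q) * (NumberField.discr K / ((-1 : ℤ) ^ (q / 2) * q)) ∧
      (NumberField.discr K / ((-1 : ℤ) ^ (q / 2) * q)) % 4 = 1 ∧
      Squarefree (NumberField.discr K / ((-1 : ℤ) ^ (q / 2) * q)) ∧
      ¬ (q : ℤ) ∣ (NumberField.discr K / ((-1 : ℤ) ^ (q / 2) * q)) ∧
      ¬ (p : ℤ) ∣ (NumberField.discr K / ((-1 : ℤ) ^ (q / 2) * q)) ∧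
      (∀ ℓ : ℕ, ℓ.Prime → (ℓ : ℤ) ∣ (NumberField.discr K / ((-1 : ℤ) ^ (q / 2) * q)) →
        ¬ ℓ ∣ W.conductorNorm ℤ) := by
  set d : ℤ := NumberField.discr K with hd
  set qs : ℤ := (-1 : ℤ) ^ (q / 2) * q with hqs
  obtain ⟨h8, h4, hodd, hsqf⟩ := discr_emod_eight_of_two_split K hK h2K
  -- `q* ∣ d`
  have hqsd : qs ∣ d := by
    rcases neg_one_pow_eq_or ℤ (q / 2) with h | h <;> simp only [hqs, h, one_mul, neg_one_mul, neg_dvd]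
    · exact hqd
    · exact hqd
  have hfac : d = qs * (d / qs) := (Int.mul_ediv_cancel' hqsd).symm
  set δ : ℤ := d / qs with hδ
  have hqs4 : qs % 4 = 1 := pStar_emod_four (p := q) hq2
  have hqs0 : qs ≠ 0 := by
    rw [hqs]; exact mul_ne_zero (pow_ne_zero _ (by norm_num)) (by exact_mod_cast hq.out.ne_zero)
  -- `δ ≡ 1 (mod 4)`
  have hδ4 : δ % 4 = 1 := by
    have h1 : (qs * δ) % 4 = 1 := by rw [← hfac]; exact h4
    have h2 : (qs * δ) % 4 = ((qs % 4) * (δ % 4)) % 4 := Int.mul_emod _ _ _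
    rw [hqs4, one_mul, Int.emod_emod_of_dvd _ (dvd_refl (4 : ℤ))] at h2
    omega
  -- square-free and `q ∤ δ`
  have hsqδ : Squarefree δ := hsqf.squarefree_of_dvd ⟨qs, by rw [mul_comm]; exact hfac⟩
  have hqδ : ¬ (q : ℤ) ∣ δ := by
    intro hqδ'
    have hqq : (q : ℤ) * q ∣ d := by
      rw [hfac]
      refine mul_dvd_mul ?_ hqδ'
      rcases neg_one_pow_eq_or ℤ (q / 2) with h | h <;> simp [hqs, h]
    have hunit := hsqf (q : ℤ) hqq
    exact hq.out.ne_one (by simpa using Int.isUnit_iff_natAbs_eq.mp hunit)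
  -- primes of `δ` are good primes of `E` (they divide `d_K`, are `≠ q`, and bad primes `≠ q` split)
  have hgood : ∀ ℓ : ℕ, ℓ.Prime → (ℓ : ℤ) ∣ δ → ¬ ℓ ∣ W.conductorNorm ℤ := by
    intro ℓ hℓ hℓδ hℓN
    have hℓd : (ℓ : ℤ) ∣ d := hℓδ.trans ⟨qs, by rw [mul_comm]; exact hfac⟩
    have hℓq : ℓ ≠ q := by rintro rfl; exact hqδ hℓδ
    have hs := hsplit ℓ hℓ hℓN hℓq
    exact Literature.SatisfiesHeegnerHypothesis.not_dvd_discr hK.1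
      (N := ℓ) (fun r hr hrℓ ↦ by rwa [(Nat.prime_dvd_prime_iff_eq hr hℓ).mp hrℓ]) hℓ dvd_rfl hℓd
  have hpδ : ¬ (p : ℤ) ∣ δ := fun h ↦ hgood p hp.out h hpN
  exact ⟨hfac, hδ4, hsqδ, hqδ, hpδ, hgood⟩

end GenusFactor

end Summit.BirchSwinnertonDyer.BirchSwinnertonDyer.Theorems.ThreeFieldRoadSupply

end
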